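import Summits.NavierStokesRegularity.NavierStokesRegularity.Theorems.FilamentSkeletonRssCoreLinearInvertibilityRadialBlockToolsA

/-!
# Tools B for stub `stub_radialBlock` of crux `CoreLinearInvertibility`
# (stmt-NavierStokesRegularity-17973), line `Sketch`: the far field and the one-variable radial bound

Continuation of tools A (one-variable Hardy estimates for the radial profile `W` of a radial
mass-zero vorticity, flux `J = rW' + (r²/2)W`, `J' = rF`, weight `e^{βr²/4}`, `β ∈ (0, 1]`):

* `radial_near_sq_le` — the NEAR-FIELD sup bound `W(r)² ≤ 2 W(0)² + 16 e⁸ N` on `[0, 4]`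
  (the first-order ODE `(e^{r²/4} W)' = e^{r²/4} J / r` integrated from the centre);
* `radial_far_le` — the FAR-FIELD weighted moments `∫₄ᵇ e^{βr²/4} W² r^{2k+1}` (`k ≤ 2`) are
  bounded by the value `W(4)²` and the flux norm: integrate `(e^{βr²/4} W² r^{2k})'` over `[4, b]`
  and substitute `rW' = J − (r²/2)W`; the leading term `−(1 − β/2) e^{βr²/4} W² r^{2k+1}` has the
  good sign (this is where the Gaussian weight `G_λ⁻¹` beats the growing Kummer branch);
* `radial_profile_bound` — the assembled one-variable inequality
  `∫₀ᵇ e^{βr²/4} ((1 + r²) W² + r² W'²) r ≤ C_β ∫₀ᵇ e^{βr²/4} F² r`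
  for every profile with `W(b) = W'(b) = 0` and zero mass `∫₀ᵇ W r = 0`, `C_β = 3·10⁵ e¹² / β²`.
-/

set_option linter.dupNamespace false

noncomputable section

namespace Summit.NavierStokesRegularity.NavierStokesRegularity.Theorems

open MeasureTheory Filter Topology Set intervalIntegral

/-! ### The near-field sup bound -/

/-- **Near-field sup bound** from the centre: with `U = e^{r²/4} W`, `U' = e^{r²/4}(W₁ + (r/2)W)` and
`(W₁ + (r/2)W)² = J²/r² ≤ N/2`, so on `[0, 4]`
`W(r)² ≤ U(r)² ≤ 2 W(0)² + 16 e⁸ N`. [folklore] -/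
theorem radial_near_sq_le {b N : ℝ} (hb : 4 ≤ b) {W W₁ J : ℝ → ℝ}
    (hW : ∀ r, HasDerivAt W (W₁ r) r) (hW₁c : Continuous W₁)
    (hJ : ∀ r, J r = r * W₁ r + r ^ 2 / 2 * W r)
    (hJsq : ∀ r ∈ Icc 0 b, J r ^ 2 ≤ r ^ 2 / 2 * N) {r : ℝ} (hr : r ∈ Icc 0 4) :
    W r ^ 2 ≤ 2 * W 0 ^ 2 + 16 * Real.exp 8 * N := by
  have hWc : Continuous W := continuous_iff_continuousAt.2 fun r => (hW r).continuousAt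
  have hec : Continuous fun s : ℝ => Real.exp (1 / 4 * s ^ 2) :=
    Real.continuous_exp.comp (continuous_const.mul (continuous_id.pow 2))
  set q : ℝ → ℝ := fun r => W₁ r + r / 2 * W r with hq
  have hqc : Continuous q := hW₁c.add ((continuous_id.div_const 2).mul hWc)
  have hq_sq : ∀ s ∈ Ioo 0 b, q s ^ 2 ≤ N / 2 := by
    intro s hs
    have hJs : J s = s * q s := by rw [hJ]; simp only [hq]; ring
    have h := hJsq s ⟨hs.1.le, hs.2.le⟩
    rw [hJs, mul_pow] at h
    have hs2 : 0 < s ^ 2 := by have := hs.1; positivity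
    exact le_of_mul_le_mul_left (by linarith) hs2
  have hU : ∀ s, HasDerivAt (fun s => Real.exp (1 / 4 * s ^ 2) * W s)
      (Real.exp (1 / 4 * s ^ 2) * q s) s := by
    intro s
    refine ((hasDerivAt_exp_mul_sq (1 / 4) s).mul (hW s)).congr_deriv ?_
    simp only [hq]
    ring
  have hftc : ∫ s in 0..r, Real.exp (1 / 4 * s ^ 2) * q s = Real.exp (1 / 4 * r ^ 2) * W r - W 0 := by
    rw [integral_eq_sub_of_hasDerivAt (fun s _ => hU s) ((hec.mul hqc).intervalIntegrable _ _)]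
    simp
  have hcs := sq_intervalIntegral_mul_le hr.1 (f := fun _ => (1 : ℝ))
    (g := fun s => Real.exp (1 / 4 * s ^ 2) * q s)
    intervalIntegrable_const (((hec.mul hqc).pow 2).intervalIntegrable _ _)
    ((continuous_const.mul (hec.mul hqc)).intervalIntegrable _ _)
  have h1c : ∫ s in (0 : ℝ)..r, (fun _ => (1 : ℝ)) s ^ 2 = r := by simp
  have h1m : ∫ s in (0 : ℝ)..r, (fun _ => (1 : ℝ)) s * (Real.exp (1 / 4 * s ^ 2) * q s) =
      ∫ s in (0 : ℝ)..r, Real.exp (1 / 4 * s ^ 2) * q s :=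
    intervalIntegral.integral_congr fun s _ => one_mul _
  rw [h1c, h1m] at hcs
  have hint : ∫ s in 0..r, (Real.exp (1 / 4 * s ^ 2) * q s) ^ 2 ≤ ∫ s in (0 : ℝ)..r, Real.exp 8 * (N / 2) := by
    refine intervalIntegral.integral_mono_on_of_le_Ioo hr.1 (((hec.mul hqc).pow 2).intervalIntegrable _ _)
      intervalIntegrable_const fun s hs => ?_
    have hs4 : s ≤ 4 := hs.2.le.trans hr.2
    have he : Real.exp (1 / 4 * s ^ 2) ^ 2 ≤ Real.exp 8 := by
      rw [← Real.exp_nat_mul, Real.exp_le_exp]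
      push_cast
      nlinarith [hs.1]
    have hq2 := hq_sq s ⟨hs.1, hs.2.trans_le (hr.2.trans hb)⟩
    rw [mul_pow]
    exact mul_le_mul he hq2 (sq_nonneg _) (Real.exp_pos _).le
  rw [intervalIntegral.integral_const, sub_zero, smul_eq_mul] at hint
  have hN0 : 0 ≤ N := by
    have h := hJsq 0 ⟨le_rfl, by linarith⟩
    have h1 := hq_sq 1 ⟨zero_lt_one, by linarith⟩
    nlinarith [sq_nonneg (q 1)]
  have hV : (Real.exp (1 / 4 * r ^ 2) * W r - W 0) ^ 2 ≤ 8 * Real.exp 8 * N := by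
    rw [← hftc]
    calc (∫ s in 0..r, Real.exp (1 / 4 * s ^ 2) * q s) ^ 2
        ≤ r * ∫ s in 0..r, (Real.exp (1 / 4 * s ^ 2) * q s) ^ 2 := hcs
      _ ≤ r * (r * (Real.exp 8 * (N / 2))) := mul_le_mul_of_nonneg_left hint hr.1
      _ ≤ 4 * (4 * (Real.exp 8 * (N / 2))) := by
          have hK : 0 ≤ Real.exp 8 * (N / 2) := by positivity
          exact mul_le_mul hr.2 (mul_le_mul_of_nonneg_right hr.2 hK) (mul_nonneg hr.1 hK) (by norm_num)
      _ = 8 * Real.exp 8 * N := by ring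
  have he1 : 1 ≤ Real.exp (1 / 4 * r ^ 2) := Real.one_le_exp (by positivity)
  have h1 : (Real.exp (1 / 4 * r ^ 2) * W r) ^ 2 ≤
      2 * (Real.exp (1 / 4 * r ^ 2) * W r - W 0) ^ 2 + 2 * W 0 ^ 2 := by
    nlinarith [sq_nonneg (Real.exp (1 / 4 * r ^ 2) * W r - 2 * W 0)]
  have h2 : W r ^ 2 ≤ (Real.exp (1 / 4 * r ^ 2) * W r) ^ 2 := by
    rw [mul_pow]
    exact le_mul_of_one_le_left (sq_nonneg _) (one_le_pow₀ he1)
  linarith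

/-! ### The far field -/

/-- **Far-field weighted moments.** For `W' = W₁`, `J = rW₁ + (r²/2)W`, `W(b) = 0`, `b ≥ 4`,
`0 < β ≤ 1` and `k ≤ 2`:
`∫₄ᵇ e^{βr²/4} W² r^{2k+1} ≤ 8 e⁴ 4^{2k} W(4)² + 64 ∫₀ᵇ e^{βr²/4} J² r`
(fundamental theorem of calculus for `e^{βr²/4} W² r^{2k}` on `[4, b]`, `2WW₁ = 2WJ/r − rW²`,
`2|WJ| r^{2k−1} ≤ W² r^{2k+1}/8 + 8 J² r`, `2k r^{2k−1} ≤ (k/8) r^{2k+1}`). [folklore] -/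
theorem radial_far_le {β b NJ M2 : ℝ} (hβ1 : β ≤ 1) (hb : 4 ≤ b) {W W₁ J : ℝ → ℝ}
    (hW : ∀ r, HasDerivAt W (W₁ r) r) (hW₁c : Continuous W₁) (hJc : Continuous J)
    (hJ : ∀ r, J r = r * W₁ r + r ^ 2 / 2 * W r) (hWb : W b = 0)
    (hNJ : ∫ r in 0..b, Real.exp (β / 4 * r ^ 2) * J r ^ 2 * r ≤ NJ)
    (hM : W 4 ^ 2 ≤ M2) {k : ℕ} (hk : k ≤ 2) :
    ∫ r in 4..b, Real.exp (β / 4 * r ^ 2) * W r ^ 2 * r ^ (2 * k + 1) ≤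
      8 * Real.exp 4 * 4 ^ (2 * k) * M2 + 64 * NJ := by
  have hWc : Continuous W := continuous_iff_continuousAt.2 fun r => (hW r).continuousAt
  have hEc : Continuous fun r : ℝ => Real.exp (β / 4 * r ^ 2) :=
    Real.continuous_exp.comp (continuous_const.mul (continuous_id.pow 2))
  set Φ' : ℝ → ℝ := fun r => 2 * (β / 4) * r * Real.exp (β / 4 * r ^ 2) * W r ^ 2 * r ^ (2 * k) +
      Real.exp (β / 4 * r ^ 2) * (2 * W r * W₁ r) * r ^ (2 * k) +
      Real.exp (β / 4 * r ^ 2) * W r ^ 2 * (((2 * k : ℕ) : ℝ) * r ^ (2 * k - 1)) with hΦ'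
  have hΦ : ∀ r, HasDerivAt (fun s => Real.exp (β / 4 * s ^ 2) * W s ^ 2 * s ^ (2 * k)) (Φ' r) r := by
    intro r
    have h2 : HasDerivAt (fun s => W s ^ 2) (2 * W r * W₁ r) r := by
      simpa using (hW r).fun_pow 2
    refine (((hasDerivAt_exp_mul_sq (β / 4) r).mul h2).mul (hasDerivAt_pow (2 * k) r)).congr_deriv ?_
    simp only [hΦ', Pi.mul_apply]
    ring
  have hΦ'c : Continuous Φ' := by
    simp only [hΦ']
    exact ((((((continuous_const.mul continuous_id).mul hEc).mul (hWc.pow 2)).mul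
      (continuous_id.pow _)).add ((hEc.mul ((continuous_const.mul hWc).mul hW₁c)).mul
      (continuous_id.pow _))).add ((hEc.mul (hWc.pow 2)).mul (continuous_const.mul (continuous_id.pow _))))
  have hftc : ∫ r in 4..b, Φ' r = -(Real.exp (β / 4 * 4 ^ 2) * W 4 ^ 2 * 4 ^ (2 * k)) := by
    rw [integral_eq_sub_of_hasDerivAt (fun r _ => hΦ r) (hΦ'c.intervalIntegrable _ _), hWb]
    ring
  -- the pointwise inequality on `[4, b]`
  have hpt : ∀ r ∈ Icc 4 b, Φ' r + 1 / 8 * (Real.exp (β / 4 * r ^ 2) * W r ^ 2 * r ^ (2 * k + 1)) ≤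
      8 * (Real.exp (β / 4 * r ^ 2) * J r ^ 2 * r) := by
    intro r hr
    have hr0 : 0 < r := by linarith [hr.1]
    have hE0 : 0 < Real.exp (β / 4 * r ^ 2) := Real.exp_pos _
    have hP0 : 0 ≤ r ^ (2 * k) := by positivity
    have hPr : r ^ (2 * k + 1) = r ^ (2 * k) * r := by rw [pow_succ]
    have hP4 : r ^ (2 * k) ≤ r ^ 4 := pow_le_pow_right₀ (by linarith [hr.1]) (by omega)
    have hQ : ((2 * k : ℕ) : ℝ) * r ^ (2 * k - 1) * 16 ≤ ((2 * k : ℕ) : ℝ) * (r ^ (2 * k) * r) := by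
      rcases Nat.eq_zero_or_pos k with rfl | hk0
      · simp
      · have e : r ^ (2 * k) * r = r ^ (2 * k - 1) * r ^ 2 := by
          rw [← pow_succ, ← pow_add]
          congr 1
          omega
        rw [e]
        have h16 : (16 : ℝ) ≤ r ^ 2 := by nlinarith [hr.1]
        have h0 : (0 : ℝ) ≤ ((2 * k : ℕ) : ℝ) * r ^ (2 * k - 1) := by positivity
        calc ((2 * k : ℕ) : ℝ) * r ^ (2 * k - 1) * 16 ≤ ((2 * k : ℕ) : ℝ) * r ^ (2 * k - 1) * r ^ 2 :=
              mul_le_mul_of_nonneg_left h16 h0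
          _ = _ := by ring
    have hW₁ : W₁ r = (J r - r ^ 2 / 2 * W r) / r := by
      rw [hJ]
      field_simp
      ring
    -- (a) substitute `rW₁ = J − (r²/2) W`
    have ha : Real.exp (β / 4 * r ^ 2) * (2 * W r * W₁ r) * r ^ (2 * k) =
        2 * Real.exp (β / 4 * r ^ 2) * W r * J r * r ^ (2 * k) / r -
          Real.exp (β / 4 * r ^ 2) * W r ^ 2 * (r ^ (2 * k) * r) := by
      rw [hW₁]
      field_simp
    -- (b) Young's inequality for the cross term
    have hb' : 2 * Real.exp (β / 4 * r ^ 2) * W r * J r * r ^ (2 * k) / r ≤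
        1 / 8 * (Real.exp (β / 4 * r ^ 2) * W r ^ 2 * (r ^ (2 * k) * r)) +
          8 * (Real.exp (β / 4 * r ^ 2) * J r ^ 2 * r ^ (2 * k) / r ^ 3) := by
      have key : 0 ≤ Real.exp (β / 4 * r ^ 2) * r ^ (2 * k) * (W r * r ^ 2 - 8 * J r) ^ 2 / (8 * r ^ 3) := by
        positivity
      have e : 1 / 8 * (Real.exp (β / 4 * r ^ 2) * W r ^ 2 * (r ^ (2 * k) * r)) +
          8 * (Real.exp (β / 4 * r ^ 2) * J r ^ 2 * r ^ (2 * k) / r ^ 3) -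
          2 * Real.exp (β / 4 * r ^ 2) * W r * J r * r ^ (2 * k) / r =
          Real.exp (β / 4 * r ^ 2) * r ^ (2 * k) * (W r * r ^ 2 - 8 * J r) ^ 2 / (8 * r ^ 3) := by
        field_simp
        ring
      linarith
    -- (c) `r^{2k}/r³ ≤ r`
    have hc : Real.exp (β / 4 * r ^ 2) * J r ^ 2 * r ^ (2 * k) / r ^ 3 ≤
        Real.exp (β / 4 * r ^ 2) * J r ^ 2 * r := by
      rw [div_le_iff₀ (by positivity)]
      have h1 : Real.exp (β / 4 * r ^ 2) * J r ^ 2 * r ^ (2 * k) ≤ Real.exp (β / 4 * r ^ 2) * J r ^ 2 * r ^ 4 :=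
        mul_le_mul_of_nonneg_left hP4 (by positivity)
      calc _ ≤ Real.exp (β / 4 * r ^ 2) * J r ^ 2 * r ^ 4 := h1
        _ = _ := by ring
    -- (d) the lower-order term
    have hd : Real.exp (β / 4 * r ^ 2) * W r ^ 2 * (((2 * k : ℕ) : ℝ) * r ^ (2 * k - 1)) ≤
        (k : ℝ) / 8 * (Real.exp (β / 4 * r ^ 2) * W r ^ 2 * (r ^ (2 * k) * r)) := by
      have h1 : ((2 * k : ℕ) : ℝ) * r ^ (2 * k - 1) ≤ (k : ℝ) / 8 * (r ^ (2 * k) * r) := by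
        push_cast at hQ ⊢
        linarith
      have h2 := mul_le_mul_of_nonneg_left h1 (by positivity : 0 ≤ Real.exp (β / 4 * r ^ 2) * W r ^ 2)
      calc _ ≤ Real.exp (β / 4 * r ^ 2) * W r ^ 2 * ((k : ℝ) / 8 * (r ^ (2 * k) * r)) := h2
        _ = _ := by ring
    have hk' : (k : ℝ) ≤ 2 := by exact_mod_cast hk
    have hA0 : 0 ≤ Real.exp (β / 4 * r ^ 2) * W r ^ 2 * (r ^ (2 * k) * r) := by positivity
    have hβA : β * (Real.exp (β / 4 * r ^ 2) * W r ^ 2 * (r ^ (2 * k) * r)) ≤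
        Real.exp (β / 4 * r ^ 2) * W r ^ 2 * (r ^ (2 * k) * r) := mul_le_of_le_one_left hA0 hβ1
    have hkA : (k : ℝ) * (Real.exp (β / 4 * r ^ 2) * W r ^ 2 * (r ^ (2 * k) * r)) ≤
        2 * (Real.exp (β / 4 * r ^ 2) * W r ^ 2 * (r ^ (2 * k) * r)) := mul_le_mul_of_nonneg_right hk' hA0
    have hΦ'r : Φ' r = 2 * (β / 4) * r * Real.exp (β / 4 * r ^ 2) * W r ^ 2 * r ^ (2 * k) +
        Real.exp (β / 4 * r ^ 2) * (2 * W r * W₁ r) * r ^ (2 * k) +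
        Real.exp (β / 4 * r ^ 2) * W r ^ 2 * (((2 * k : ℕ) : ℝ) * r ^ (2 * k - 1)) := rfl
    have e1 : 2 * (β / 4) * r * Real.exp (β / 4 * r ^ 2) * W r ^ 2 * r ^ (2 * k) =
        β / 2 * (Real.exp (β / 4 * r ^ 2) * W r ^ 2 * (r ^ (2 * k) * r)) := by ring
    rw [hΦ'r, hPr, ha, e1]
    linarith [hb', hc, hd, hβA, hkA]
  -- integrate the pointwise inequality
  have hI : IntervalIntegrable (fun r => Real.exp (β / 4 * r ^ 2) * W r ^ 2 * r ^ (2 * k + 1)) volume 4 b :=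
    ((hEc.mul (hWc.pow 2)).mul (continuous_id.pow _)).intervalIntegrable _ _
  have hIJ : IntervalIntegrable (fun r => Real.exp (β / 4 * r ^ 2) * J r ^ 2 * r) volume 4 b :=
    ((hEc.mul (hJc.pow 2)).mul continuous_id).intervalIntegrable _ _
  have hmono : ∫ r in 4..b, (Φ' r + 1 / 8 * (Real.exp (β / 4 * r ^ 2) * W r ^ 2 * r ^ (2 * k + 1))) ≤
      ∫ r in 4..b, 8 * (Real.exp (β / 4 * r ^ 2) * J r ^ 2 * r) :=
    intervalIntegral.integral_mono_on hb ((hΦ'c.intervalIntegrable _ _).add (hI.const_mul _))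
      (hIJ.const_mul _) hpt
  rw [intervalIntegral.integral_add (hΦ'c.intervalIntegrable _ _) (hI.const_mul _),
    intervalIntegral.integral_const_mul, intervalIntegral.integral_const_mul, hftc] at hmono
  -- `∫₄ᵇ e J² r ≤ NJ`
  have hJ4 : ∫ r in 4..b, Real.exp (β / 4 * r ^ 2) * J r ^ 2 * r ≤ NJ := by
    refine le_trans ?_ hNJ
    refine intervalIntegral.integral_mono_interval (by norm_num) hb le_rfl ?_
      (((hEc.mul (hJc.pow 2)).mul continuous_id).intervalIntegrable _ _)
    filter_upwards [ae_restrict_mem measurableSet_Ioc] with s hs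
    exact mul_nonneg (mul_nonneg (Real.exp_pos _).le (sq_nonneg _)) hs.1.le
  -- `e^{4β} ≤ e⁴`
  have hE4 : Real.exp (β / 4 * 4 ^ 2) * W 4 ^ 2 * 4 ^ (2 * k) ≤ Real.exp 4 * 4 ^ (2 * k) * M2 := by
    have h1 : Real.exp (β / 4 * 4 ^ 2) ≤ Real.exp 4 := Real.exp_le_exp.2 (by nlinarith)
    calc Real.exp (β / 4 * 4 ^ 2) * W 4 ^ 2 * 4 ^ (2 * k) = Real.exp (β / 4 * 4 ^ 2) * 4 ^ (2 * k) * W 4 ^ 2 := by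
          ring
      _ ≤ Real.exp 4 * 4 ^ (2 * k) * M2 :=
          mul_le_mul (mul_le_mul_of_nonneg_right h1 (by positivity)) hM (sq_nonneg _) (by positivity)
  linarith


/-! ### The one-variable radial bound -/

/-- **The one-variable radial bound.** Let `0 < β ≤ 1`, `b ≥ 4`, `W ∈ C¹` with `W' = W₁` continuous,
`F` continuous, `J = rW₁ + (r²/2)W` with `J' = rF` on `[0, b]` (the radial form of
`L w = f`, `L = Δ + ½x·∇ + 1`), `W(b) = W₁(b) = 0` and ZERO MASS `∫₀ᵇ W r dr = 0`. Then
`∫₀ᵇ e^{βr²/4} ((1 + r²) W² + r² W₁²) r ≤ (3·10⁵ e¹²/β²) ∫₀ᵇ e^{βr²/4} F² r`.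
(Hardy for the flux, the pinned centre value, the near-field sup bound, the far-field moments,
and `r²W₁² ≤ 2J² + r⁴W²/2`.) [folklore] -/
theorem radial_profile_bound {β : ℝ} (hβ : 0 < β) (hβ1 : β ≤ 1) {b : ℝ} (hb : 4 ≤ b)
    {W W₁ F J : ℝ → ℝ} (hW : ∀ r, HasDerivAt W (W₁ r) r) (hW₁c : Continuous W₁) (hFc : Continuous F)
    (hJ : ∀ r, J r = r * W₁ r + r ^ 2 / 2 * W r) (hJ' : ∀ r ∈ Icc 0 b, HasDerivAt J (r * F r) r)
    (hWb : W b = 0) (hW₁b : W₁ b = 0) (hmass : ∫ r in 0..b, W r * r = 0) :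
    ∫ r in 0..b, Real.exp (β / 4 * r ^ 2) * ((1 + r ^ 2) * W r ^ 2 + r ^ 2 * W₁ r ^ 2) * r ≤
      300000 * Real.exp 12 / β ^ 2 * ∫ r in 0..b, Real.exp (β / 4 * r ^ 2) * F r ^ 2 * r := by
  have hb0 : (0 : ℝ) ≤ b := by linarith
  have hb1 : (1 : ℝ) ≤ b := by linarith
  have hWc : Continuous W := continuous_iff_continuousAt.2 fun r => (hW r).continuousAt
  have hEc : Continuous fun r : ℝ => Real.exp (β / 4 * r ^ 2) :=
    Real.continuous_exp.comp (continuous_const.mul (continuous_id.pow 2))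
  have hJc : Continuous J := by
    rw [show J = fun r => r * W₁ r + r ^ 2 / 2 * W r from funext hJ]
    exact (continuous_id.mul hW₁c).add (((continuous_id.pow 2).div_const 2).mul hWc)
  have hJ0 : J 0 = 0 := by rw [hJ]; ring
  have hJb : J b = 0 := by rw [hJ, hWb, hW₁b]; ring
  set N := ∫ r in 0..b, Real.exp (β / 4 * r ^ 2) * F r ^ 2 * r with hN
  set NJ := ∫ r in 0..b, Real.exp (β / 4 * r ^ 2) * J r ^ 2 * r with hNJ
  have hN0 : 0 ≤ N := intervalIntegral.integral_nonneg hb0 fun r hr =>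
    mul_nonneg (mul_nonneg (Real.exp_pos _).le (sq_nonneg _)) hr.1
  have hNJ0 : 0 ≤ NJ := intervalIntegral.integral_nonneg hb0 fun r hr =>
    mul_nonneg (mul_nonneg (Real.exp_pos _).le (sq_nonneg _)) hr.1
  -- the four one-variable estimates
  have hHardy : NJ ≤ 16 / β ^ 2 * N := radial_hardy_flux hβ hb0 hJc hFc hJ' hJ0 hJb
  have hJsq : ∀ r ∈ Icc 0 b, J r ^ 2 ≤ r ^ 2 / 2 * N := fun r hr =>
    radial_flux_sq_le hβ.le hFc hJ' hJ0 hr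
  have hW0 : W 0 ^ 2 ≤ N + 2 * NJ := radial_center_sq_le hβ.le hb1 hW hW₁c hJc hJ hJsq hWb hmass
  set M2 := 2 * W 0 ^ 2 + 16 * Real.exp 8 * N with hM2
  have hnear : ∀ r ∈ Icc 0 4, W r ^ 2 ≤ M2 := fun r hr => radial_near_sq_le hb hW hW₁c hJ hJsq hr
  have hM20 : 0 ≤ M2 := by positivity
  -- integrability of the moment integrands
  have hIk : ∀ (k : ℕ) (u v : ℝ), IntervalIntegrable
      (fun r => Real.exp (β / 4 * r ^ 2) * W r ^ 2 * r ^ (2 * k + 1)) volume u v := fun k u v =>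
    ((hEc.mul (hWc.pow 2)).mul (continuous_id.pow _)).intervalIntegrable _ _
  -- near-field moments
  have hnearI : ∀ k : ℕ, ∫ r in 0..4, Real.exp (β / 4 * r ^ 2) * W r ^ 2 * r ^ (2 * k + 1) ≤
      4 * (Real.exp 4 * M2 * 4 ^ (2 * k + 1)) := by
    intro k
    have h := intervalIntegral.integral_mono_on (by norm_num : (0 : ℝ) ≤ 4) (hIk k 0 4)
      (intervalIntegrable_const (c := Real.exp 4 * M2 * 4 ^ (2 * k + 1))) fun r hr => by
        have h1 : Real.exp (β / 4 * r ^ 2) ≤ Real.exp 4 := Real.exp_le_exp.2 (by nlinarith [hr.1, hr.2])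
        have h2 : W r ^ 2 ≤ M2 := hnear r hr
        have h3 : r ^ (2 * k + 1) ≤ 4 ^ (2 * k + 1) := pow_le_pow_left₀ hr.1 hr.2 _
        exact mul_le_mul (mul_le_mul h1 h2 (sq_nonneg _) (Real.exp_pos _).le) h3
          (by have := hr.1; positivity) (by positivity)
    rw [intervalIntegral.integral_const, sub_zero, smul_eq_mul] at h
    exact h
  -- far-field moments
  have hfarI : ∀ k : ℕ, k ≤ 2 → ∫ r in 4..b, Real.exp (β / 4 * r ^ 2) * W r ^ 2 * r ^ (2 * k + 1) ≤
      8 * Real.exp 4 * 4 ^ (2 * k) * M2 + 64 * NJ := fun k hk =>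
    radial_far_le hβ1 hb hW hW₁c hJc hJ hWb le_rfl (hnear 4 ⟨by norm_num, le_rfl⟩) hk
  have hT : ∀ k : ℕ, k ≤ 2 → ∫ r in 0..b, Real.exp (β / 4 * r ^ 2) * W r ^ 2 * r ^ (2 * k + 1) ≤
      4 * (Real.exp 4 * M2 * 4 ^ (2 * k + 1)) + (8 * Real.exp 4 * 4 ^ (2 * k) * M2 + 64 * NJ) := by
    intro k hk
    rw [← intervalIntegral.integral_add_adjacent_intervals (hIk k 0 4) (hIk k 4 b)]
    exact add_le_add (hnearI k) (hfarI k hk)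
  have hT0 := hT 0 (by norm_num); have hT1 := hT 1 (by norm_num); have hT2 := hT 2 (by norm_num)
  norm_num only at hT0 hT1 hT2
  -- the gradient term through the flux: `r² W₁² ≤ 2 J² + r⁴ W²/2`
  have hIW₁ : IntervalIntegrable (fun r => Real.exp (β / 4 * r ^ 2) * (r ^ 2 * W₁ r ^ 2) * r) volume 0 b :=
    ((hEc.mul ((continuous_id.pow 2).mul (hW₁c.pow 2))).mul continuous_id).intervalIntegrable _ _
  have hIJ : IntervalIntegrable (fun r => Real.exp (β / 4 * r ^ 2) * J r ^ 2 * r) volume 0 b :=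
    ((hEc.mul (hJc.pow 2)).mul continuous_id).intervalIntegrable _ _
  have hW₁I : ∫ r in 0..b, Real.exp (β / 4 * r ^ 2) * (r ^ 2 * W₁ r ^ 2) * r ≤
      2 * NJ + 1 / 2 * ∫ r in 0..b, Real.exp (β / 4 * r ^ 2) * W r ^ 2 * r ^ (2 * 2 + 1) := by
    have h := intervalIntegral.integral_mono_on hb0 hIW₁ ((hIJ.const_mul 2).add ((hIk 2 0 b).const_mul _))
      fun r hr => by
        have e : r * W₁ r = J r - r ^ 2 / 2 * W r := by rw [hJ]; ring
        have h0 : 0 ≤ Real.exp (β / 4 * r ^ 2) * r := mul_nonneg (Real.exp_pos _).le hr.1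
        have h1 : r ^ 2 * W₁ r ^ 2 ≤ 2 * J r ^ 2 + 1 / 2 * (W r ^ 2 * r ^ 4) := by
          have : r ^ 2 * W₁ r ^ 2 = (J r - r ^ 2 / 2 * W r) ^ 2 := by rw [← e]; ring
          rw [this]
          nlinarith [sq_nonneg (J r + r ^ 2 / 2 * W r)]
        have h2 := mul_le_mul_of_nonneg_left h1 h0
        have e2 : Real.exp (β / 4 * r ^ 2) * r * (2 * J r ^ 2 + 1 / 2 * (W r ^ 2 * r ^ 4)) =
            2 * (Real.exp (β / 4 * r ^ 2) * J r ^ 2 * r) +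
              1 / 2 * (Real.exp (β / 4 * r ^ 2) * W r ^ 2 * r ^ (2 * 2 + 1)) := by ring
        calc Real.exp (β / 4 * r ^ 2) * (r ^ 2 * W₁ r ^ 2) * r
            = Real.exp (β / 4 * r ^ 2) * r * (r ^ 2 * W₁ r ^ 2) := by ring
          _ ≤ _ := h2
          _ = _ := e2
    rw [intervalIntegral.integral_add (hIJ.const_mul 2) ((hIk 2 0 b).const_mul _),
      intervalIntegral.integral_const_mul, intervalIntegral.integral_const_mul] at h
    exact h
  norm_num only at hW₁I
  -- decomposition of the left-hand side
  have hLHS : ∫ r in 0..b, Real.exp (β / 4 * r ^ 2) * ((1 + r ^ 2) * W r ^ 2 + r ^ 2 * W₁ r ^ 2) * r =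
      ((∫ r in 0..b, Real.exp (β / 4 * r ^ 2) * W r ^ 2 * r ^ 1) +
        ∫ r in 0..b, Real.exp (β / 4 * r ^ 2) * W r ^ 2 * r ^ 3) +
        ∫ r in 0..b, Real.exp (β / 4 * r ^ 2) * (r ^ 2 * W₁ r ^ 2) * r := by
    rw [← intervalIntegral.integral_add (hIk 0 0 b) (hIk 1 0 b), ← intervalIntegral.integral_add
      ((hIk 0 0 b).add (hIk 1 0 b)) hIW₁]
    exact intervalIntegral.integral_congr fun r _ => by ring
  rw [hLHS]
  -- bookkeeping of the constants
  set K := Real.exp 12 with hK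
  set n := N / β ^ 2 with hn
  have hβ2 : β ^ 2 ≤ 1 := by nlinarith
  have hβ20 : 0 < β ^ 2 := by positivity
  have hn0 : 0 ≤ n := by positivity
  have hNn : N ≤ n := by
    rw [hn, le_div_iff₀ hβ20]
    nlinarith
  have hNJn : NJ ≤ 16 * n := by rw [hn]; linarith [hHardy, show 16 / β ^ 2 * N = 16 * (N / β ^ 2) by ring]
  have he4 : Real.exp 4 ≤ K := Real.exp_le_exp.2 (by norm_num)
  have hK1 : 1 ≤ K := Real.one_le_exp (by norm_num)
  have he40 : 0 ≤ Real.exp 4 := (Real.exp_pos 4).le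
  have he48 : Real.exp 4 * Real.exp 8 = K := by rw [hK, ← Real.exp_add]; norm_num
  have hM2' : Real.exp 4 * M2 ≤ 2 * (Real.exp 4 * N) + 4 * (Real.exp 4 * NJ) + 16 * (K * N) := by
    have h1 : M2 ≤ 2 * N + 4 * NJ + 16 * Real.exp 8 * N := by rw [hM2]; linarith
    have h2 := mul_le_mul_of_nonneg_left h1 he40
    calc Real.exp 4 * M2 ≤ Real.exp 4 * (2 * N + 4 * NJ + 16 * Real.exp 8 * N) := h2
      _ = 2 * (Real.exp 4 * N) + 4 * (Real.exp 4 * NJ) + 16 * (Real.exp 4 * Real.exp 8 * N) := by ring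
      _ = _ := by rw [he48]
  have p1 : Real.exp 4 * N ≤ K * n := mul_le_mul he4 hNn hN0 (by positivity)
  have p2 : Real.exp 4 * NJ ≤ K * (16 * n) := mul_le_mul he4 hNJn hNJ0 (by positivity)
  have p3 : K * N ≤ K * n := mul_le_mul_of_nonneg_left hNn (by positivity)
  have p4 : n ≤ K * n := le_mul_of_one_le_left hn0 hK1
  have hgoal : 300000 * Real.exp 12 / β ^ 2 * N = 300000 * (K * n) := by
    rw [hK, hn]
    ring
  rw [hgoal]
  linarith [hT0, hT1, hT2, hW₁I, hM2', p1, p2, p3, p4, hNJn]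


/-- Registered tools stub of crux stmt-NavierStokesRegularity-17973 (`stub_radialBlockToolsB`):
the near-field sup bound, the far-field weighted moments, and the assembled one-variable radial
bound `∫₀ᵇ e^{βr²/4}((1 + r²)W² + r²W₁²) r ≤ (3·10⁵e¹²/β²) ∫₀ᵇ e^{βr²/4} F² r`. [folklore] -/
theorem stub_radialBlockToolsB :
    (∀ (b N : ℝ) (W W₁ J : ℝ → ℝ), 4 ≤ b → (∀ r, HasDerivAt W (W₁ r) r) → Continuous W₁ →
      (∀ r, J r = r * W₁ r + r ^ 2 / 2 * W r) → (∀ r ∈ Set.Icc 0 b, J r ^ 2 ≤ r ^ 2 / 2 * N) →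
      ∀ r ∈ Set.Icc 0 4, W r ^ 2 ≤ 2 * W 0 ^ 2 + 16 * Real.exp 8 * N) ∧
    (∀ (β b NJ M2 : ℝ) (W W₁ J : ℝ → ℝ) (k : ℕ), β ≤ 1 → 4 ≤ b → (∀ r, HasDerivAt W (W₁ r) r) →
      Continuous W₁ → Continuous J → (∀ r, J r = r * W₁ r + r ^ 2 / 2 * W r) → W b = 0 →
      (∫ r in 0..b, Real.exp (β / 4 * r ^ 2) * J r ^ 2 * r ≤ NJ) → W 4 ^ 2 ≤ M2 → k ≤ 2 →
      ∫ r in 4..b, Real.exp (β / 4 * r ^ 2) * W r ^ 2 * r ^ (2 * k + 1) ≤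
        8 * Real.exp 4 * 4 ^ (2 * k) * M2 + 64 * NJ) ∧
    (∀ (β b : ℝ) (W W₁ F J : ℝ → ℝ), 0 < β → β ≤ 1 → 4 ≤ b → (∀ r, HasDerivAt W (W₁ r) r) →
      Continuous W₁ → Continuous F → (∀ r, J r = r * W₁ r + r ^ 2 / 2 * W r) →
      (∀ r ∈ Set.Icc 0 b, HasDerivAt J (r * F r) r) → W b = 0 → W₁ b = 0 →
      ∫ r in 0..b, W r * r = 0 →
      ∫ r in 0..b, Real.exp (β / 4 * r ^ 2) * ((1 + r ^ 2) * W r ^ 2 + r ^ 2 * W₁ r ^ 2) * r ≤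
        300000 * Real.exp 12 / β ^ 2 * ∫ r in 0..b, Real.exp (β / 4 * r ^ 2) * F r ^ 2 * r) :=
  ⟨fun _ _ _ _ _ hb hW hW₁c hJ hJsq _ hr => radial_near_sq_le hb hW hW₁c hJ hJsq hr,
    fun _ _ _ _ _ _ _ _ hβ1 hb hW hW₁c hJc hJ hWb hNJ hM hk =>
      radial_far_le hβ1 hb hW hW₁c hJc hJ hWb hNJ hM hk,
    fun _ _ _ _ _ _ hβ hβ1 hb hW hW₁c hFc hJ hJ' hWb hW₁b hmass =>
      radial_profile_bound hβ hβ1 hb hW hW₁c hFc hJ hJ' hWb hW₁b hmass⟩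

end Summit.NavierStokesRegularity.NavierStokesRegularity.Theorems
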